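import Literature.MathematicalPhysics.QuantumFieldTheory.Balaban1983to89.B9Cor36GCubeAtLocCfg
import Literature.MathematicalPhysics.QuantumFieldTheory.Balaban1983to89.B9Cor36GCubeEntriesAtV
import Literature.MathematicalPhysics.QuantumFieldTheory.Balaban1983to89.B9Thm33CubeAtOneRight
import Literature.MathematicalPhysics.QuantumFieldTheory.Balaban1983to89.B9Ineq386RightEntry

/-!
# `Balaban1983to89.B9Cor36GCubeRightEntryAtLocCfg` — COROLLARY 3.6 p. 408 FOR THE BOND-SECTOR CUBE LETTER `G_□ = Δ_{a,□}⁻¹` AT THE LOCALISED FIELD `Ṽ_□ = e^{iηχ̃_□A}`: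
# THE RIGHT ENTRY (3.42)₃ `G_□(Ṽ_□)∇*_ν ≺ B₂·Lⁿη·e^{−ρd}` — the flat half `hR` of G-F6b's `eBlock_locLetterBY` (cell GAPS G-B9-02, entry n = 2), from Theorem 3.3's right
# entry at `U = 1` (E1 `thm33_GK_cube_right`), the left resolvent law of (3.86) (G-F7 v1.1), r06's `gExt_rightEntry_of_386L`, and ONE displayed input `hDiv` = the
# left composite `G_□(1)·V ≺ κ_D·s·e^{−ρ_Dd}` of layer L-DIV (sub-row G-B9-LETTERS, module M5.1b-G, programme RIGHT-ENTRY-V, layer L-ASM; lead ruling «G-F8 SPLIT»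
# HOME/INBOX 2026-08-28T20:29:30Z)

statement-level skeleton of published theorems with citation tags; proofs where landed; nothing here is a claim about the Yang–Mills mass gap

Sources under audit (cell lit-balaban): T. Bałaban, *Propagators for lattice gauge theories in a background field*, Commun. Math. Phys. **99** (1985) 389–434
[`Balaban1985BackgroundPropagators`, "B9"], Cor. 3.6 p. 408, Thm 3.4 p. 400, (3.84)–(3.86) p. 407, Thm 3.3 p. 399, (3.42) p. 397, p. 398 l. 20–24, Cor. 3.5 p. 407, p. 409
l. 1–5; [4] = T. Bałaban, *Propagators and renormalization transformations for lattice gauge theories. II*, Commun. Math. Phys. **96** (1984) 223–250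
[`Balaban1984PropagatorsII`], Prop. 2.6 (2.136) p. 247, Lemma 2.1 ∕ (2.61) ∕ (2.66) p. 234, (2.51) p. 232.  Unit `lit-balaban-p33` (p33 gen 102); B9 fold owner r06; referee ref-4.

## WHAT IS PRINTED (verbatim up to notation)

p. 407: «G(U′U) = G(U)(I − V(A)G(U))⁻¹ = Σ_{n=0}^∞ G(U)(V(A)G(U))ⁿ, (3.86) … Theorem (3.3) implies also convergence in all norms appearing in its formulation, thus in all
norms on the left-hand sides of the inequalities (3.42)–(3.47). This way we get all these inequalities for the operator G(U′U)»; p. 397 (3.42), third entry: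
«|(G′(U)∇*_Uλ)(x)| ≦ B₀Lʲη e^{−δ₀d(y,y′)}|λ|»; p. 399 Thm 3.3: «the operator G(U) (a = 1) satisfies the inequalities (3.42)–(3.47), with G′(U) replaced by G(U)»; p. 408
Cor. 3.6 l. 7–14: «If a configuration U satisfies (3.35) with O(1)Mα₀ ≦ a₁ … then Theorems 3.1-3.3 hold for the operators G′(U), (Q′(U)G′²(U)Q′*(U))⁻¹, G(U) constructed for
the sequence {Ω′_j}»; p. 398 l. 20–24: «we may always replace ∇_U by ∇*_U, and vice versa … Using Lemma 2.1 in [4] we may replace the factor (Lʲη)^α by (Lʲη)^β(L^{j′}η)^γ».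

## WHY THIS FILE

G-F6b `B9Cor36GCubeLocAtMember.eBlock_locLetterBY` (p663680) delivers M5.7's per-cube `hE` MODULO ONE displayed input per cube: the flat right entry
`hR : ∀ν GVK(Ṽ_□)·conj b(cdsBₗ 1 ν) ≺ B₂·len·e^{−ρ′d}`.  By the lead's «G-F8 SPLIT» the proof of `hR` is cut in two layers: L-DIV (p38) — the left composite
`G_□(1)·V(Ṽ_□) ≺ θ·e^{−ρd}`, `θ ∝ s`, from a divergence-form reading of `V = Δ_{a,□}(1) − Δ_{a,□}(Ṽ_□)` at def-Y's letters; L-ASM (this file) — everything else: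
(3.42)₃ for `G_□(1)` (E1, the level-0 transposed walk), the left resolvent law `GVK = GK + GK·VK·GVK` (G-F7 v1.1), [4] (2.61) and the p. 398 convention on the cube
sequence's geometry (`exists_h261_geoCK`, `hST_geoCK`), the located smallness from `s ≤ a₁`, and r06's fixed-point theorem `gExt_rightEntry_of_386L`.  The L-DIV
statement enters HERE AS THE DISPLAYED HYPOTHESIS `hDiv` (in r06's `hGV` shape at p38's cube letters, `θ := κ_D·s`), to be fed BY NAME when it lands.

## WHAT THIS FILE CERTIFIES (kernel-checked; theorems only; 0 `def`, 0 `def … : Prop`, 0 sorry; standard axioms)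

* §1 `conj_cdsBₗ_one` — the consumer's letter IS E1's letter: `conj b(∇*_{1,ν}) = DsK b i ν` (twin of G-F6a's `conj_cdBₗ_one`).
* §2 ★★★ `cor36_G_cube_rightEntry_at_locCfg` — GIVEN `hDiv` (for some `ρ_D > 0`, `κ_D ≥ 0`, thresholds `M_D, T_D, N_D`, size threshold `a_D > 0`: for every member above
  the thresholds, every cover cube and every (3.35) cube datum with `s = sRead C Λ ≤ a_D`, `GK·VK(Ṽ_□) ≺ κ_D·s·e^{−ρ_Dd}` over `(toB6 (geoCK i □) Rr H, blkBK i □)`),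
  THERE ARE `ρ > 0`, `B₂ ≥ 0`, thresholds `M₀, T₀, N₀`, `a₁ > 0` — functions of `d, L, b₀, b₁, M₂` and the `hDiv` data only — such that for every member above the
  thresholds, every cover cube `□`, every `Rr, H`, every (3.35) cube datum `(A, Q, C, ξ, Λ)` (G-F7's binders VERBATIM) with `s ≤ a₁`, and every direction `ν`:
  `HasMajorant (toB6 (geoCK i □) Rr H) (blkBK i □) (GVK b i □ (parSymY i) (parBY i) Ṽ_□ * conj b (cdsBₗ i 1 ν)) (B₂·(geoCK i □).len a·e^{−ρ·d(a,a′)})` — EXACTLY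
  `eBlock_locLetterBY`'s `hR` (the consumer takes `ρ′ := min δ ρ`).  Constants: `ρ = (1 − 27∕5000)·min(ρ_D, σ₁∕4)`, `B₂ = 2A_R·L⁸·c₁`, `a₁ = min(a₇, a_D, (2(κ_Dc₁ + 1))⁻¹)`.

## HONEST SCOPE

Assembly over landed modules (E1, G-F7 v1.1, G-F6a letters, r06 §2, p33 5a geometry) plus ONE DISPLAYED INPUT `hDiv` (layer L-DIV, p38's lineage; its divergence-form
reading is print's (3.70)–(3.73) read from the input side under the p. 398 licence — NOT proved here); the (3.35) cube datum, member thresholds, `s ≤ a₁`, `parS = parSymY i`,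
`parB = parBY i` displayed as in G-F7.  NOT here: the Hölder ∕ `L²` entries, the defect majorants `locDefectBY ∕ locDefectTBY`, the plug into `eBlock_locLetterBY` (next file).
Count-neutral; NOT a node discharge; no summit ∕ sub-problem statement is proved; nothing continuum ∕ OS ∕ mass-gap ∕ Clay; YM mass gap NOT proved by any of this (Track A
conditional rung).  No `sorry`, no `axiom`, no `… : Prop` fact, no `instance`, no `notation`.  NEW file; nothing landed is modified.  `--supports stmt-QuantumFields-19200`.
Net new unproved facts: 0.

RELATED IN THE TREE, NOT DUPLICATED (searched 2026-08-28: `rg 'rightEntry_at_locCfg|conj_cdsBₗ_one'` over `Literature/` = ∅): E1 `B9Thm33CubeAtOneRight` (`U = 1`), G-F7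
`B9Cor36GCubeAtLocCfg` (left entries), r06 `B9Ineq386RightEntry` (letter-free), p33 `B9Ineq386RightEntryDirs` (multi-letter, for L-DIV road (ii)) — all USED BY NAME or upstream.
-/

noncomputable section

namespace Literature.MathematicalPhysics.QuantumFieldTheory.Balaban1983to89.B9Cor36GCubeRightEntryAtLocCfg

open NormedSpace Complex
open B6RandomWalk (HasMajorant hasMajorant_mono Ineq261 c1_nonneg)
open B9Thm34Ext (toB6)
open B9Ineq347 (ScaleTransfer)
open B9Eq352DivFormLetters (conj)
open B9Eq39Adjoint (covD)
open B6KLevelCensusIndexV1 (KIdx kGeo)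
open B6Cover236MultiLevelBlocks (cubes)
open B6GlobalChartV1 (PV boxEquiv)
open B9BackgroundsKLevelV1 (shiftsV1)
open B9Eq360DeltaPrimeAY (AfldY)
open B9CubeLettersBondOpsL0 (BlkCubeY deltaACubeY)
open B9CubeGeometryInputs (geoCK geoCK_len_pos geoCK_dist_axioms RM1 N1 exists_h261_geoCK hST_geoCK)
open B9Cor36CubeCutoffs (SC NearC locCfgY)
open B9Cor35GCubeInputsAtOne (blkBK GK GVK VK)
open B9Cor35CinvAtCubeLetters (kernel_rate_mono)
open B9Cor36GCubeWindows (sRead sRead_nonneg)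
open B9Cor36GCubeAtLocCfg (cor36_G_cube_at_locCfg')
open B9Cor36GCubeEntriesAtV (conj_congr_of_liftY)
open B9Thm33CubeAtOneRight (DsK thm33_GK_cube_right)
open B9Ineq386RightEntry (gExt_rightEntry_of_386L)
open B9Cor35ComparisonsGAAtLetters (cdsB_one_liftY)
open B9CoReadingCoords (cdsBₗ cdsBₗ_apply)
open Node00 (SiteY CfgY FBondY SiteParY toKT parSymY parSymY_one parBY parBY_one liftY liftEndY liftEndY_liftY cdsB)

variable {d ℓ : ℕ} {hd : 1 ≤ d + 1} {hL : Odd (ℓ + 1) ∧ 1 < ℓ + 1} {b₀ b₁ : ℝ}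
variable {𝔸 : Type} [NormedRing 𝔸] [NormedAlgebra ℂ 𝔸] [CompleteSpace 𝔸]
variable {ι : Type} [Fintype ι] (b : Module.Basis ι ℝ 𝔸)

/-! ## §1  The consumer's right letter `conj b(∇*_{1,ν})` IS E1's `DsK` -/

section Letter

variable (i : KIdx d ℓ hd hL b₀ b₁)

/-- `conj b(∇*_{1,ν}) = DsK b i ν`: def-Y's flat adjoint bond derivative realified is E1's letter (the lift of r03's `DVa ν c_f`; r05's `cdsB_one_liftY` on product vectors,
G-F6a's `conj_congr_of_liftY`) — twin of G-F6a's `conj_cdBₗ_one`. [cite: Balaban1985BackgroundPropagators, (3.8) p.392, (3.42) p.397 (third entry), p.395 («coincides … if U = 1»), bookkeeping] -/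
theorem conj_cdsBₗ_one (ν : Fin (d + 1)) : conj b (cdsBₗ i (fun _ _ => (1 : 𝔸ˣ)) ν) = DsK b i ν := by
  rw [DsK]
  refine conj_congr_of_liftY b _ _ fun f E => ?_
  rw [cdsBₗ_apply, cdsB_one_liftY, LinearMap.restrictScalars_apply, liftEndY_liftY]

end Letter

/-! ## §2  ★★★ The right entry (3.42)₃ of `G_□(Ṽ_□)`, uniformly in the member and the cube, from `hDiv` -/

section Main

set_option maxHeartbeats 1600000 in
/-- ★★★ **COROLLARY 3.6 FOR THE BOND-SECTOR CUBE LETTER, THE RIGHT ENTRY (3.42)₃ `G_□(Ṽ_□)∇*_ν ≺ B₂·Lⁿη·e^{−ρd}` — THE FLAT HALF `hR` OF G-F6b's `eBlock_locLetterBY`,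
MODULO THE LEFT COMPOSITE `hDiv` OF LAYER L-DIV.**  GIVEN `hDiv`: constants `ρ_D > 0`, `κ_D ≥ 0`, thresholds `M_D, T_D, N_D` and a size threshold `a_D > 0` such that for every
member above them, every cover cube `□`, every `Rr, H` and every (3.35) cube datum `(A, Q, C, ξ, Λ)` (G-F7's binders verbatim) with `sRead C Λ ≤ a_D`:
`GK·VK(Ṽ_□) ≺ κ_D·sRead C Λ·e^{−ρ_D d}` over `(toB6 (geoCK i □) Rr H, blkBK i □)` (r06's `hGV` slot; print: the divergence-form reading of (3.70)–(3.73) under the p. 398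
licence and (3.85)'s mechanism on the other side).  THEN there are `ρ > 0`, `B₂ ≥ 0`, thresholds `M₀, T₀, N₀` and `a₁ > 0` — functions of `d, L, b₀, b₁, M₂` and the `hDiv`
data — such that for every member above the thresholds, every cover cube, every `Rr, H`, every (3.35) cube datum with `sRead C Λ ≤ a₁`, and every direction `ν`:
`GVK(Ṽ_□)·conj b(∇*_{1,ν}) ≺ B₂·(geoCK i □).len a·e^{−ρ·d(a,a′)}`.  PROOF = print's: (3.86) in the left resolvent form `G(Ṽ) = G(1) + G(1)V G(Ṽ)` (G-F7 v1.1) times `∇*_ν`,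
the fixed point closed by [4] Lemma 2.1 at `(ρ₀, 9∕5000)` and the p. 398 convention (r06's `gExt_rightEntry_of_386L`), with Theorem 3.3's right entry for `G_□(1)`
(E1 `thm33_GK_cube_right`, `σ = σ₁`, `α = 1∕2`) and `hDiv`, both rate-weakened to `ρ₀ = min(ρ_D, σ₁∕4)`; smallness `κ_D·s·c₁ ≤ 1∕2` from `s ≤ a₁ ≤ (2(κ_Dc₁+1))⁻¹`.
[cite: Balaban1985BackgroundPropagators, Cor. 3.6 p.408, Thm 3.4 p.400, (3.84)–(3.86) p.407, Thm 3.3 p.399, (3.42) p.397 (third entry), p.398 l.20–24, Cor. 3.5 p.407, p.409 l.1–5; Balaban1984PropagatorsII, Prop. 2.6 (2.136) p.247, Lemma 2.1 (2.61) p.234, (2.66) p.234, (2.51) p.232] -/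
theorem cor36_G_cube_rightEntry_at_locCfg [NormOneClass 𝔸] [DecidableEq ι] (hℓ : 1 ≤ ℓ) (hb₀ : 0 < b₀) (hb₁ : b₀ ≤ b₁) (M₂ : ℝ) (hM₂ : 0 ≤ M₂)
    (hrepr : ∀ (v : 𝔸) (j : ι), |b.repr v j| ≤ M₂ * ‖v‖)
    {ρD κD MD TD aD : ℝ} {ND : ℕ} (hρD : 0 < ρD) (hκD : 0 ≤ κD) (haD : 0 < aD)
    (hDiv : ∀ (i : KIdx d ℓ hd hL b₀ b₁) (c : ↥(cubes (toKT i).D.toDomains)) (Rr : ℝ) (H : Prop),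
      MD ≤ ((ℓ : ℝ) + 1) * (toKT i).Mh → ND + 1 ≤ (toKT i).R * ((ℓ + 1) * (toKT i).Mh) → TD ≤ RM1 i →
      ∀ (A : AfldY 𝔸 i) (Q : Set (Site (PV d ℓ i.m i.K hd hL) 0)) (C ξ Λ : ℝ),
      0 ≤ C → 0 < ξ → 1 ≤ Λ → ξ ≤ 5 * (SC i c : ℝ) * (kGeo i).eta → LatticeNorms.scaleLen ((ℓ : ℝ) + 1) (kGeo i).eta (c.1.1 + 1) ≤ Λ * ξ →
      (∀ x : Site (PV d ℓ i.m i.K hd hL) 0, NearC i c (35 * SC i c / 8 + 1) (boxEquiv i.hN x).1 → x ∈ Q) →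
      (∀ κ, ∀ x ∈ Q, ‖A κ x‖ ≤ C * ξ⁻¹) →
      (∀ μ ν, ∀ x ∈ Q, ‖(((kGeo i).eta : ℂ)⁻¹) • covD (shiftsV1 (PV d ℓ i.m i.K hd hL)) (fun _ _ => (1 : 𝔸ˣ)) μ (A ν) x‖ ≤ C * (ξ ^ 2)⁻¹) →
      (∀ (t : ℝ) (κ : Fin (d + 1)) (x : Site (PV d ℓ i.m i.K hd hL) 0), ‖NormedSpace.exp ((I * (t : ℂ)) • A κ x)‖ ≤ 1) →
      sRead C Λ ≤ aD →
      HasMajorant (g := toB6 (geoCK i c) Rr H) (blkBK i c)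
        (GK b i c (parSymY i) (parBY i) * VK b i c (parSymY i) (parBY i) (locCfgY i c (kGeo i).eta A))
        (fun a a' => κD * sRead C Λ * Real.exp (-(ρD * (geoCK i c).dist a a')))) :
    ∃ ρ B₂ M₀ T₀ : ℝ, ∃ N₀ : ℕ, 0 < ρ ∧ 0 ≤ B₂ ∧ ∃ a₁ : ℝ, 0 < a₁ ∧
    ∀ (i : KIdx d ℓ hd hL b₀ b₁) (c : ↥(cubes (toKT i).D.toDomains)) (Rr : ℝ) (H : Prop),
      M₀ ≤ ((ℓ : ℝ) + 1) * (toKT i).Mh → N₀ + 1 ≤ (toKT i).R * ((ℓ + 1) * (toKT i).Mh) → T₀ ≤ RM1 i →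
    ∀ (A : AfldY 𝔸 i) (Q : Set (Site (PV d ℓ i.m i.K hd hL) 0)) (C ξ Λ : ℝ),
      0 ≤ C → 0 < ξ → 1 ≤ Λ → ξ ≤ 5 * (SC i c : ℝ) * (kGeo i).eta → LatticeNorms.scaleLen ((ℓ : ℝ) + 1) (kGeo i).eta (c.1.1 + 1) ≤ Λ * ξ →
      (∀ x : Site (PV d ℓ i.m i.K hd hL) 0, NearC i c (35 * SC i c / 8 + 1) (boxEquiv i.hN x).1 → x ∈ Q) →
      (∀ κ, ∀ x ∈ Q, ‖A κ x‖ ≤ C * ξ⁻¹) →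
      (∀ μ ν, ∀ x ∈ Q, ‖(((kGeo i).eta : ℂ)⁻¹) • covD (shiftsV1 (PV d ℓ i.m i.K hd hL)) (fun _ _ => (1 : 𝔸ˣ)) μ (A ν) x‖ ≤ C * (ξ ^ 2)⁻¹) →
      (∀ (t : ℝ) (κ : Fin (d + 1)) (x : Site (PV d ℓ i.m i.K hd hL) 0), ‖NormedSpace.exp ((I * (t : ℂ)) • A κ x)‖ ≤ 1) →
      sRead C Λ ≤ a₁ →
      ∀ ν : Fin (d + 1), HasMajorant (g := toB6 (geoCK i c) Rr H) (blkBK i c)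
        (GVK b i c (parSymY i) (parBY i) (locCfgY i c (kGeo i).eta A) * conj b (cdsBₗ i (fun _ _ => (1 : 𝔸ˣ)) ν))
        (fun a a' => B₂ * (geoCK i c).len a * Real.exp (-(ρ * (geoCK i c).dist a a'))) := by
  -- G-F7 v1.1: the unit, the two (3.86) laws (we use law 1, the LEFT resolvent form)
  obtain ⟨ρ₇, θ₇, M₇, T₇, N₇, -, -, a₇, ha₇, AG, -, h7⟩ := cor36_G_cube_at_locCfg' b hℓ hb₀ hb₁ M₂ hM₂ hrepr
  -- E1: Theorem 3.3's right entry for `G_□(1)` at `(σ₁, α = 1∕2)`, rate `σ₁∕4`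
  obtain ⟨σ₁, hσ₁, hE⟩ := thm33_GK_cube_right (d := d) (ℓ := ℓ) (hd := hd) (hL := hL) (𝔸 := 𝔸) b hb₀ hb₁
  obtain ⟨AR, MR, hAR, hMR, hE'⟩ := hE σ₁ hσ₁ le_rfl (1 / 2) (by norm_num) (by norm_num)
  -- the working rate
  set ρ₀ : ℝ := min ρD (σ₁ / 4) with hρ₀def
  have hρ₀ : 0 < ρ₀ := lt_min hρD (by positivity)
  have hρ₀D : ρ₀ ≤ ρD := min_le_left _ _
  have hρ₀E : ρ₀ ≤ (1 - 1 / 2) * σ₁ / 2 := by rw [hρ₀def]; have := min_le_right ρD (σ₁ / 4); linarith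
  -- [4] (2.61) at `(ρ₀, 9∕5000)` on the cube sequence's geometry
  obtain ⟨dB, h261⟩ := exists_h261_geoCK d ℓ hρ₀
  set c₁ : ℝ := B6.c1 dB ρ₀ (9 / 5000) with hc₁def
  have hc₁ : 0 ≤ c₁ := c1_nonneg _ _ _
  -- the size threshold
  set a₁ : ℝ := min a₇ (min aD (1 / (2 * (κD * c₁ + 1)))) with ha₁def
  have hκc : 0 < κD * c₁ + 1 := by positivity
  have ha₁ : 0 < a₁ := lt_min ha₇ (lt_min haD (by positivity))
  set Λ4 : ℝ := ((ℓ : ℝ) + 1) ^ 4 with hΛ4def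
  have hΛ4 : 0 ≤ Λ4 := by positivity
  refine ⟨(1 - 3 * (9 / 5000)) * ρ₀, 2 * AR * Λ4 ^ 2 * c₁, max M₇ (max MD MR), max T₇ (max TD (4 * Real.log ((ℓ : ℝ) + 1) / (9 / 5000 * ρ₀))),
    max N₇ (max ND (N1 d ℓ (9 / 5000 * ρ₀))), by positivity, by positivity, a₁, ha₁, ?_⟩
  intro i c Rr H hM hN hT A Q C ξ Λ hC hξ hΛ hξS hΛξ hQ hA hdA hAu hsa ν
  -- thresholds
  have hM₇ : M₇ ≤ ((ℓ : ℝ) + 1) * (toKT i).Mh := (le_max_left _ _).trans hM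
  have hMD : MD ≤ ((ℓ : ℝ) + 1) * (toKT i).Mh := ((le_max_left _ _).trans (le_max_right _ _)).trans hM
  have hMR' : MR ≤ ((ℓ : ℝ) + 1) * i.Mh := ((le_max_right _ _).trans (le_max_right _ _)).trans hM
  have hN₇ : N₇ + 1 ≤ (toKT i).R * ((ℓ + 1) * (toKT i).Mh) := le_trans (Nat.succ_le_succ (le_max_left _ _)) hN
  have hND : ND + 1 ≤ (toKT i).R * ((ℓ + 1) * (toKT i).Mh) := le_trans (Nat.succ_le_succ ((le_max_left _ _).trans (le_max_right _ _))) hN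
  have hN1 : N1 d ℓ (9 / 5000 * ρ₀) + 1 ≤ (toKT i).R * ((ℓ + 1) * (toKT i).Mh) :=
    le_trans (Nat.succ_le_succ ((le_max_right _ _).trans (le_max_right _ _))) hN
  have hT₇ : T₇ ≤ RM1 i := (le_max_left _ _).trans hT
  have hTD : TD ≤ RM1 i := ((le_max_left _ _).trans (le_max_right _ _)).trans hT
  have hT1 : 4 * Real.log ((ℓ : ℝ) + 1) / (9 / 5000 * ρ₀) ≤ RM1 i := ((le_max_right _ _).trans (le_max_right _ _)).trans hT
  -- sizes
  set s : ℝ := sRead C Λ with hsdef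
  have hs0 : 0 ≤ s := sRead_nonneg hC Λ
  have hs₇ : s ≤ a₇ := hsa.trans (min_le_left _ _)
  have hsD : s ≤ aD := hsa.trans ((min_le_right _ _).trans (min_le_left _ _))
  have hsκ : s ≤ 1 / (2 * (κD * c₁ + 1)) := hsa.trans ((min_le_right _ _).trans (min_le_right _ _))
  -- geometry
  obtain ⟨hdnn, htri, hrefl, hsym⟩ := geoCK_dist_axioms i c Rr H
  have hparS : ∀ z w : SiteY i, parSymY i (fun _ _ => (1 : 𝔸ˣ)) z w = 1 := fun z w => parSymY_one i z w
  have hparB : ∀ s s', parBY (𝔸 := 𝔸) i (fun _ _ => 1) s s' = 1 := fun s s' => parBY_one i s s'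
  -- G-F7: law 1 `GVK = GK + GK·VK·GVK`
  obtain ⟨-, ⟨hlaw1, -⟩, -, -, -⟩ := h7 i c Rr H hM₇ hN₇ hT₇ A Q C ξ Λ hC hξ hΛ hξS hΛξ hQ hA hdA hAu hs₇
  -- E1 at the cube, rate-weakened to `ρ₀`
  have h342 : HasMajorant (g := toB6 (geoCK i c) Rr H) (blkBK i c) (GK b i c (parSymY i) (parBY i) * DsK b i ν)
      (fun a a' => AR * (geoCK i c).len a * Real.exp (-(ρ₀ * (geoCK i c).dist a a'))) :=
    hasMajorant_mono (g := toB6 (geoCK i c) Rr H) _ (hE' i c Rr H (parSymY i) (parBY i) hparS hparB hMR' ν) fun a a' =>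
      kernel_rate_mono hdnn hρ₀E (mul_nonneg hAR (geoCK_len_pos i c a).le) a a'
  -- hDiv at the cube, rate-weakened to `ρ₀`
  have hGV : HasMajorant (g := toB6 (geoCK i c) Rr H) (blkBK i c)
      (GK b i c (parSymY i) (parBY i) * VK b i c (parSymY i) (parBY i) (locCfgY i c (kGeo i).eta A))
      (fun a a' => κD * s * Real.exp (-(ρ₀ * (geoCK i c).dist a a'))) :=
    hasMajorant_mono (g := toB6 (geoCK i c) Rr H) _ (hDiv i c Rr H hMD hND hTD A Q C ξ Λ hC hξ hΛ hξS hΛξ hQ hA hdA hAu hsD) fun a a' =>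
      kernel_rate_mono hdnn hρ₀D (mul_nonneg hκD hs0) a a'
  -- (2.61) and the convention at `(ρ₀, 9∕5000)`
  have h261' : Ineq261 dB (toB6 (geoCK i c) Rr H) ρ₀ (9 / 5000) := h261 i c Rr H hN1 (9 / 5000) le_rfl (by norm_num)
  obtain ⟨hST1, -⟩ := hST_geoCK i c hρ₀ hT1 (9 / 5000) le_rfl
  -- the located smallness `κ_D·s·c₁ ≤ 1∕2`
  have hθc : κD * s * c₁ ≤ 1 / 2 := by
    have h1 : κD * s * c₁ = (κD * c₁) * s := by ring
    rw [h1]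
    calc (κD * c₁) * s ≤ (κD * c₁) * (1 / (2 * (κD * c₁ + 1))) := mul_le_mul_of_nonneg_left hsκ (mul_nonneg hκD hc₁)
      _ = (κD * c₁) / (κD * c₁ + 1) / 2 := by field_simp
      _ ≤ 1 / 2 := by
          have : (κD * c₁) / (κD * c₁ + 1) ≤ 1 := by rw [div_le_one hκc]; linarith
          linarith
  have hsmall : κD * s * B6.c1 dB ρ₀ (9 / 5000) < 1 := by rw [← hc₁def]; linarith
  have hinv2 : (1 - κD * s * B6.c1 dB ρ₀ (9 / 5000))⁻¹ ≤ 2 := by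
    rw [← hc₁def]
    calc (1 - κD * s * c₁)⁻¹ ≤ (1 / 2)⁻¹ := inv_anti₀ (by norm_num) (by linarith)
      _ = 2 := by norm_num
  -- r06's fixed point: (3.86) law 1 × `∇*_ν` on the right
  have key := gExt_rightEntry_of_386L (R := Rr) (H := H) (blkBK i c) dB ρ₀ (9 / 5000) (κD * s) AR Λ4 (fun a => (geoCK i c).len a) hAR hΛ4
    (fun a => (geoCK_len_pos i c a).le) (mul_nonneg hκD hs0) hρ₀.le (by norm_num) (by positivity) (by nlinarith) htri hrefl hsym hdnn h261' hsmall hST1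
    h342 hGV hlaw1
  rw [conj_cdsBₗ_one]
  refine hasMajorant_mono (g := toB6 (geoCK i c) Rr H) _ key fun a a' => ?_
  have hw : 0 ≤ (geoCK i c).len a * Real.exp (-((1 - 3 * (9 / 5000)) * ρ₀ * (geoCK i c).dist a a')) :=
    mul_nonneg (geoCK_len_pos i c a).le (Real.exp_nonneg _)
  calc AR * Λ4 ^ 2 * B6.c1 dB ρ₀ (9 / 5000) * (1 - κD * s * B6.c1 dB ρ₀ (9 / 5000))⁻¹ * (geoCK i c).len a *
        Real.exp (-((1 - 3 * (9 / 5000)) * ρ₀ * (geoCK i c).dist a a'))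
      = (AR * Λ4 ^ 2 * c₁) * (1 - κD * s * B6.c1 dB ρ₀ (9 / 5000))⁻¹ *
          ((geoCK i c).len a * Real.exp (-((1 - 3 * (9 / 5000)) * ρ₀ * (geoCK i c).dist a a'))) := by rw [hc₁def]; ring
    _ ≤ (AR * Λ4 ^ 2 * c₁) * 2 * ((geoCK i c).len a * Real.exp (-((1 - 3 * (9 / 5000)) * ρ₀ * (geoCK i c).dist a a'))) := by gcongr
    _ = 2 * AR * Λ4 ^ 2 * c₁ * (geoCK i c).len a * Real.exp (-((1 - 3 * (9 / 5000)) * ρ₀ * (geoCK i c).dist a a')) := by ring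

end Main

end Literature.MathematicalPhysics.QuantumFieldTheory.Balaban1983to89.B9Cor36GCubeRightEntryAtLocCfg

end
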